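import Mathlib
import Literature.NumberTheory.LFunctions.Zhang2022.TypedSection14Proofs
import Literature.NumberTheory.LFunctions.Zhang2022.Section14GaussSums
import Literature.NumberTheory.LFunctions.Zhang2022.Section14Summability
import Literature.NumberTheory.LFunctions.Zhang2022.PrimitiveCharOrthogonality
import Literature.NumberTheory.LFunctions.Zhang2022.Section14Majorant1413
import HarnessLib

/-!
# Zhang (2022) §14, node `Z22:§14.u006` (first line) from u004: the edge
# `step14u006a_of_u004 : Typed.Sec14.Step14u004 → Typed.Sec14.Step14u006a`

Topic `Literature/NumberTheory/LFunctions/Zhang2022` (Landau–Siegel audit tree; verdict-neutral).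
Y. Zhang, *Discrete mean estimates and the Landau–Siegel zero*, arXiv:2211.02515v1 (2022)
[Zhang2022LandauSiegel], §14 p. 77 (tex L3862–L3866): "Note that `(n,p) = 1` if `n < 2P₄` and
`|τ(χψ_p⁰)| = √D`. Hence, summing over the primitive characters `ψ (mod p)` … we find that
`Σ*_{ψ (mod p)} Ĩ₂(ψ) = τ(χ)χ(p)D⁻¹ Σ_mΣ_n κ*(m)a*(n)n⁻¹Δ₁(m/(Dpn))e(mD̄n̄/p) + O(PT^{−c})`" —
**an unrefereed manuscript under adjudication**; nothing here asserts or denies its Theorems 1–2,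
Proposition 14.1, or anything about Landau–Siegel zeros. Campaign D-0069, discharge lane (layer L3,
seat d31). The statements `Step14u004` (u004: term-by-term integration of `Ĩ₂(ψ)`) and `Step14u006a`
(u006, first line) are L3-t7's (`TypedSection14.lean`), cited by name; this file proves the printed
implication between them ("Hence …") as a kernel edge. It composes with L3-t7's landed
`step14u006b_of_u006a` (u006 second line) and d31's `eq144_of_u008_u006b` ((14.4)).

What is PROVED here (theorems only; no FACT-LIST input; Assumption (A) enters only as the
antecedent carried by u004):

* `step14u006a_of_u004 : Step14u004 → Step14u006a` — for every `B`, with `c = min(c₄, 1)` and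
  `C = 2C₄⁺ + 36B²K_W` (`c₄, C₄` the constants u004 provides for `B`; `K_W = (2C₅₃⁺+3)7¹⁶ + 4C₅₃⁺`
  the window constant of the tree's DISCHARGED Lemma 5.3, `Skeleton.lemma53_holds`). Route:
  (1) u004 summed over the `p − 2 ≤ p < 2P` members of `Ψ` with modulus `p` (`card_finsetOf_p_le`):
  error `≤ 2PC₄⁺e^{−c₄𝓛¹⁰} ≤ 2PC₄⁺T^{−c}`; (2) `Σ*_ψ` moved inside the absolutely convergent
  `m`-series (`sum_char_tsum_exchange`, `sum_mainTerm_u004_eq`; summability from (14.1) and the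
  decay of `Δ`, `Section14Summability.summable_kappa_mul_DeltaW`); (3) the character sum over the
  NON-principal `ψ (mod p)`: `Σ_{ψ≠ψ⁰} τ(χψ̄)ψ(m)ψ̄(n) = [p∤m](τ(χ)χ(p)(p−1)e(mD̄n̄/p) − τ(χψ⁰))` for
  `(n,p) = 1` (`sum_erase_one_tau_mul` = u005, d31's `step14u005_holds`, minus the principal term),
  with `(n,p) = 1` because `n ≤ 2P₄ ≤ P < p` (`Section14GaussSums.coprime_of_mem_primeWindow_of_le`)
  and `|τ(χψ⁰)| = √D` (d31's `step14p77_holds`), `|τ(χ)| = √D` (`norm_tau_eq_sqrt`); (4) the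
  coefficient discrepancy `|W(m,n)/(Dp) − τ(χ)χ(p)e/D| ≤ 2/(p√D) + [p∣m]/√D` (`norm_coeff_sub_le`);
  (5) summed with `|κ*(m)| ≤ Bτ₅(m) ≤ Bd(m)⁴`, `|a*(n)| ≤ B` and the window lemma
  `Σ_m d(m)⁴|Δ(m/X)| ≤ K_W·X·𝓛⁶⁷⁴` (d31's `Section14Majorant1413.tsum_divisors_pow_mul_norm_DeltaW_le`,
  from Lemma 5.3) at `X = Dpn`, and — for the `p ∣ m` sub-series, re-indexed `m = pk` with
  `d(pk) ≤ 2d(k)` (`tsum_ite_dvd_eq_tsum_mul`) — at `X = Dn` (`norm_mainTerms_sub_target_le`):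
  total `≤ 36B²K_W√D𝓛⁶⁷⁴P₄ = 36B²K_W·P·√D𝓛¹¹⁹³T⁻² ≤ 36B²K_W·P·T⁻¹` (`𝓛¹¹⁹³ ≤ D^{1/4}` eventually,
  `Section14Summability.eventually_log_rpow_le_rpow_quarter`; `D^{3/4} ≤ D ≤ T`).

Also public and reusable: `sum_erase_one_tau_mul`, `summable_kappa_mul_bdd_mul_Delta1`,
`sum_char_tsum_exchange`, `sum_mainTerm_u004_eq`, `norm_coeff_sub_le`,
`tsum_dvd_divisors_pow_mul_norm_DeltaW_le`, `card_finsetOf_p_le`,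
`norm_mainTerms_sub_target_le`.

## References

* Y. Zhang, arXiv:2211.02515v1 (2022), §14 pp. 76–77 (u004–u006); §5 Lemma 5.3 p. 25; §2 (2.2),
  (2.6), (2.8)–(2.10), p. 4 (`Ψ`, `p ∼ P`). [cite: Zhang2022LandauSiegel, §14 u006 p.77]
* H. L. Montgomery, R. C. Vaughan, *Multiplicative Number Theory I* (2007), Thm 9.7 (`|τ(χ)| = √q`).
  [cite: MontgomeryVaughan2007, Thm 9.7]
-/

noncomputable section

open Complex Real ComplexConjugate Finset

namespace Literature.NumberTheory.LFunctions.Zhang2022.Typed.Sec14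

open Skeleton

/-! ## The character sum over the NON-principal `ψ (mod p)` -/

/-- For a window prime `p` (`D ≥ 3`, so `p ∤ D`) and `(n,p) = 1`:
`Σ_{ψ ≠ ψ⁰ (mod p)} τ(χψ̄)ψ(m)ψ̄(n) = [p ∤ m]·(τ(χ)χ(p)(p−1)e(mD̄n̄/p) − τ(χψ⁰))` — u005 (all `ψ`,
`step14u005_holds`) minus the principal term. [cite: Zhang2022LandauSiegel, §14 u005–u006 pp.76–77] -/
theorem sum_erase_one_tau_mul {D : ℕ} [NeZero D] (χ : DirichletCharacter ℂ D)
    (h5 : ∀ p ∈ primeWindow D, ∀ m n : ℕ, Nat.Coprime (m * n) p →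
      (∑ ψ ∈ finsetOf (Set.univ : Set (DirichletCharacter ℂ p)),
        tauSum (D * p) (DirichletCharacter.changeLevel (dvd_mul_right D p) χ *
            DirichletCharacter.changeLevel (dvd_mul_left p D) ψ⁻¹) *
          ψ (m : ZMod p) * ψ⁻¹ (n : ZMod p)) =
      GammaFactor.tau χ * χ (p : ZMod D) * ((p : ℂ) - 1) * eAdd ((m : ℝ) * nInv p (D * n) / p))
    {p : ℕ} [Fact p.Prime] (hp : p ∈ primeWindow D) {m n : ℕ} (hn : Nat.Coprime n p) :
    (∑ ψ ∈ (Finset.univ : Finset (DirichletCharacter ℂ p)).erase 1,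
        tauSum (D * p) (DirichletCharacter.changeLevel (dvd_mul_right D p) χ *
            DirichletCharacter.changeLevel (dvd_mul_left p D) ψ⁻¹) *
          ψ (m : ZMod p) * ψ⁻¹ (n : ZMod p)) =
      if p ∣ m then 0 else
        GammaFactor.tau χ * χ (p : ZMod D) * ((p : ℂ) - 1) * eAdd ((m : ℝ) * nInv p (D * n) / p) -
          tauSum (D * p) (DirichletCharacter.changeLevel (dvd_mul_right D p) χ *
            DirichletCharacter.changeLevel (dvd_mul_left p D) (1 : DirichletCharacter ℂ p)) := by
  have hprime : p.Prime := Fact.out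
  haveI : NeZero p := ⟨hprime.ne_zero⟩
  split_ifs with hpm
  · -- `p ∣ m`: every term vanishes (`ψ(m) = 0`)
    refine Finset.sum_eq_zero fun ψ _ => ?_
    have hm : (m : ZMod p) = 0 := (ZMod.natCast_eq_zero_iff m p).mpr hpm
    have hnu : ¬ IsUnit (m : ZMod p) := by rw [hm]; exact not_isUnit_zero
    rw [MulChar.map_nonunit ψ hnu, mul_zero, zero_mul]
  · -- `p ∤ m`: all characters minus the principal one
    have hm : Nat.Coprime m p := (Nat.Prime.coprime_iff_not_dvd hprime).mpr hpm |>.symm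
    have hmn : Nat.Coprime (m * n) p := Nat.Coprime.mul_left hm hn
    have hall := h5 p hp m n hmn
    have hfin : finsetOf (Set.univ : Set (DirichletCharacter ℂ p)) = Finset.univ := by
      rw [finsetOf, dif_pos Set.finite_univ, Set.Finite.toFinset_univ]
    rw [hfin, ← Finset.sum_erase_add _ _ (Finset.mem_univ (1 : DirichletCharacter ℂ p))] at hall
    have h1m : (1 : DirichletCharacter ℂ p) (m : ZMod p) = 1 :=
      MulChar.one_apply (x := (m : ZMod p)) ((ZMod.isUnit_iff_coprime m p).mpr hm)
    have h1n : (1 : DirichletCharacter ℂ p)⁻¹ (n : ZMod p) = 1 := by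
      rw [inv_one]; exact MulChar.one_apply (x := (n : ZMod p)) ((ZMod.isUnit_iff_coprime n p).mpr hn)
    rw [inv_one, h1m, mul_one] at hall
    rw [inv_one] at h1n
    rw [h1n, mul_one] at hall
    linear_combination hall

/-! ## Summability of the `m`-series with a character twist -/

/-- `‖Δ₁(x)‖ = ‖Δ(x)‖`. [cite: Zhang2022LandauSiegel, §5 (5.7) p.25] -/
private theorem norm_Delta1_eq (D : ℕ) (x : ℝ) :
    ‖Lemma53.Delta1_56 (ell2 D) (t0 D) x‖ = ‖DeltaW D x‖ := by
  rw [DeltaW, Lemma53.Delta57, norm_mul,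
    show (2 : ℂ) * π * I * x = ((2 * π * x : ℝ) : ℂ) * I by push_cast; ring,
    Complex.norm_exp_ofReal_mul_I, mul_one]

/-- Under (14.1) (`D ≥ 3`, `Q > 0`): `m ↦ κ*(m)·g(m)·Δ₁(m/Q)` is summable for any bounded `g`.
[cite: Zhang2022LandauSiegel, §14 (14.4) p.77] -/
theorem summable_kappa_mul_bdd_mul_Delta1 {D : ℕ} (hD : 3 ≤ D) {B : ℝ} {κs : ℕ → ℂ} (hκ : Eq141 B κs)
    {Q : ℝ} (hQ : 0 < Q) {g : ℕ → ℂ} {G : ℝ} (hg : ∀ m, ‖g m‖ ≤ G) :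
    Summable fun m : ℕ => κs m * g m * Lemma53.Delta1_56 (ell2 D) (t0 D) ((m : ℝ) / Q) := by
  have h := summable_kappa_mul_DeltaW hD hκ 1 hQ hg
  refine Summable.of_norm_bounded h.norm (fun m => ?_)
  rw [one_mul, norm_mul, norm_mul, norm_mul, norm_mul, norm_Delta1_eq]

/-! ## The main term of `Σ*_ψ Ĩ₂(ψ)`: the character sum moved inside -/

/-- For a window prime `p` and any coefficients `τ_ψ`: the finite character sum moves inside the
absolutely convergent `m`-series:
`Σ_{ψ≠1} τ_ψ Σ_m Σ_n κ*(m)a*(n)ψ(m)ψ̄(n)n⁻¹Δ₁(m/(Dpn))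
 = Σ_m Σ_n κ*(m)a*(n)n⁻¹Δ₁(m/(Dpn)) · Σ_{ψ≠1} τ_ψ ψ(m)ψ⁻¹(n)`. [cite: Zhang2022LandauSiegel, §14 u006 p.77] -/
theorem sum_char_tsum_exchange {D : ℕ} (hD : 3 ≤ D) {B : ℝ} {κs : ℕ → ℂ} (hκ : Eq141 B κs)
    (as : ℕ → ℂ) {p : ℕ} [Fact p.Prime] (N : ℕ) (τ : DirichletCharacter ℂ p → ℂ) :
    (∑ ψ ∈ (Finset.univ : Finset (DirichletCharacter ℂ p)).erase 1,
        τ ψ * ∑' m : ℕ, ∑ n ∈ Finset.Icc 1 N, κs m * as n * ψ (m : ZMod p) *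
          conj (ψ (n : ZMod p)) / (n : ℂ) *
            Lemma53.Delta1_56 (ell2 D) (t0 D) ((m : ℝ) / ((D : ℝ) * p * n))) =
      ∑' m : ℕ, ∑ n ∈ Finset.Icc 1 N, κs m * as n / (n : ℂ) *
        Lemma53.Delta1_56 (ell2 D) (t0 D) ((m : ℝ) / ((D : ℝ) * p * n)) *
          ∑ ψ ∈ (Finset.univ : Finset (DirichletCharacter ℂ p)).erase 1,
            τ ψ * ψ (m : ZMod p) * ψ⁻¹ (n : ZMod p) := by
  have hprime : p.Prime := Fact.out
  have hD0 : (0 : ℝ) < D := by exact_mod_cast (show 0 < D by omega)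
  have hp0 : (0 : ℝ) < p := by exact_mod_cast hprime.pos
  -- summability of each `(ψ, n)` piece
  have hsum : ∀ (ψ : DirichletCharacter ℂ p) (n : ℕ), n ∈ Finset.Icc 1 N →
      Summable fun m : ℕ => κs m * as n * ψ (m : ZMod p) * conj (ψ (n : ZMod p)) / (n : ℂ) *
        Lemma53.Delta1_56 (ell2 D) (t0 D) ((m : ℝ) / ((D : ℝ) * p * n)) := by
    intro ψ n hn
    obtain ⟨hn1, _⟩ := Finset.mem_Icc.mp hn
    have hn0 : (0 : ℝ) < n := by exact_mod_cast hn1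
    have hQ : (0 : ℝ) < (D : ℝ) * p * n := by positivity
    have h := summable_kappa_mul_bdd_mul_Delta1 hD hκ hQ
      (g := fun m : ℕ => as n * ψ (m : ZMod p) * conj (ψ (n : ZMod p)) / (n : ℂ))
      (G := ‖as n‖ / n) (fun m => by
        rw [norm_div, norm_mul, norm_mul, Complex.norm_natCast]
        have h1 : ‖ψ (m : ZMod p)‖ ≤ 1 := ψ.norm_le_one _
        have h2 : ‖conj (ψ (n : ZMod p))‖ ≤ 1 := by rw [Complex.norm_conj]; exact ψ.norm_le_one _
        have h0 : 0 ≤ ‖as n‖ := norm_nonneg _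
        calc ‖as n‖ * ‖ψ (m : ZMod p)‖ * ‖conj (ψ (n : ZMod p))‖ / n ≤ ‖as n‖ * 1 * 1 / n := by
              gcongr
          _ = ‖as n‖ / n := by ring)
    refine h.congr fun m => ?_
    ring
  -- move `τ ψ` inside and exchange
  have hsumN : ∀ ψ : DirichletCharacter ℂ p, Summable fun m : ℕ => ∑ n ∈ Finset.Icc 1 N,
      κs m * as n * ψ (m : ZMod p) * conj (ψ (n : ZMod p)) / (n : ℂ) *
        Lemma53.Delta1_56 (ell2 D) (t0 D) ((m : ℝ) / ((D : ℝ) * p * n)) :=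
    fun ψ => summable_sum fun n hn => hsum ψ n hn
  calc (∑ ψ ∈ (Finset.univ : Finset (DirichletCharacter ℂ p)).erase 1,
        τ ψ * ∑' m : ℕ, ∑ n ∈ Finset.Icc 1 N, κs m * as n * ψ (m : ZMod p) *
          conj (ψ (n : ZMod p)) / (n : ℂ) *
            Lemma53.Delta1_56 (ell2 D) (t0 D) ((m : ℝ) / ((D : ℝ) * p * n)))
      = ∑ ψ ∈ (Finset.univ : Finset (DirichletCharacter ℂ p)).erase 1,
          ∑' m : ℕ, ∑ n ∈ Finset.Icc 1 N, τ ψ * (κs m * as n * ψ (m : ZMod p) *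
            conj (ψ (n : ZMod p)) / (n : ℂ) *
              Lemma53.Delta1_56 (ell2 D) (t0 D) ((m : ℝ) / ((D : ℝ) * p * n))) := by
        refine Finset.sum_congr rfl fun ψ _ => ?_
        rw [← tsum_mul_left]
        refine tsum_congr fun m => ?_
        rw [Finset.mul_sum]
    _ = ∑' m : ℕ, ∑ ψ ∈ (Finset.univ : Finset (DirichletCharacter ℂ p)).erase 1,
          ∑ n ∈ Finset.Icc 1 N, τ ψ * (κs m * as n * ψ (m : ZMod p) *
            conj (ψ (n : ZMod p)) / (n : ℂ) *
              Lemma53.Delta1_56 (ell2 D) (t0 D) ((m : ℝ) / ((D : ℝ) * p * n))) := by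
        rw [Summable.tsum_finsetSum]
        intro ψ _
        refine summable_sum fun n hn => ?_
        exact (hsum ψ n hn).mul_left (τ ψ)
    _ = _ := by
        refine tsum_congr fun m => ?_
        rw [Finset.sum_comm]
        refine Finset.sum_congr rfl fun n _ => ?_
        rw [Finset.mul_sum]
        refine Finset.sum_congr rfl fun ψ _ => ?_
        rw [PrimChar.inv_apply_eq_conj]
        ring

/-! ## The main terms of u004 summed over `Σ*_{ψ (mod p)}` -/

section MainTerm

variable {D : ℕ} [NeZero D] (χ : DirichletCharacter ℂ D)

/-- **`Σ*_{ψ (mod p)}` of the u004 main terms, with the character sum inside**: for a window prime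
`p`, real `χ` and (14.1),
`Σ_{x∈Ψ, p_x=p} main(x) = (Dp)⁻¹ Σ_m Σ_n κ*(m)a*(n)n⁻¹Δ₁(m/(Dpn)) · Σ_{ψ≠1} τ(χψ̄)ψ(m)ψ̄(n)`.
[cite: Zhang2022LandauSiegel, §14 u005–u006 pp.76–77] -/
theorem sum_mainTerm_u004_eq (hq : χ.IsQuadratic) (hD : 3 ≤ D) {B : ℝ} {κs : ℕ → ℂ}
    (hκ : Eq141 B κs) (as : ℕ → ℂ) {p : ℕ} [Fact p.Prime] (hp : p ∈ primeWindow D) :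
    ∑ x ∈ finsetOf {x : Chr D | x.p = p}, GammaFactor.tau (psiChi χ x)⁻¹ / ((D : ℂ) * x.p) *
        ∑' m : ℕ, ∑ n ∈ Finset.Icc 1 ⌊2 * P4 D⌋₊,
          κs m * as n * x.ψ (m : ZMod x.p) * conj (x.ψ (n : ZMod x.p)) / (n : ℂ) *
            Lemma53.Delta1_56 (ell2 D) (t0 D) ((m : ℝ) / ((D : ℝ) * x.p * n)) =
      ((D : ℂ) * p)⁻¹ * ∑' m : ℕ, ∑ n ∈ Finset.Icc 1 ⌊2 * P4 D⌋₊, κs m * as n / (n : ℂ) *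
        Lemma53.Delta1_56 (ell2 D) (t0 D) ((m : ℝ) / ((D : ℝ) * p * n)) *
          ∑ ψ ∈ (Finset.univ : Finset (DirichletCharacter ℂ p)).erase 1,
            tauSum (D * p) (DirichletCharacter.changeLevel (dvd_mul_right D p) χ *
                DirichletCharacter.changeLevel (dvd_mul_left p D) ψ⁻¹) *
              ψ (m : ZMod p) * ψ⁻¹ (n : ZMod p) := by
  have hprime : p.Prime := Fact.out
  haveI : NeZero p := ⟨hprime.ne_zero⟩
  -- Step 1: re-index over `ψ ≠ 1 (mod p)`
  set F : (q : ℕ) → DirichletCharacter ℂ q → ℂ := fun q ψ =>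
    tauSum (D * q) ((DirichletCharacter.changeLevel (dvd_mul_right D q) χ *
        DirichletCharacter.changeLevel (dvd_mul_left q D) ψ)⁻¹) / ((D : ℂ) * q) *
      ∑' m : ℕ, ∑ n ∈ Finset.Icc 1 ⌊2 * P4 D⌋₊,
        κs m * as n * ψ (m : ZMod q) * conj (ψ (n : ZMod q)) / (n : ℂ) *
          Lemma53.Delta1_56 (ell2 D) (t0 D) ((m : ℝ) / ((D : ℝ) * q * n)) with hF
  have hmain : ∀ x : Chr D, GammaFactor.tau (psiChi χ x)⁻¹ / ((D : ℂ) * x.p) *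
      ∑' m : ℕ, ∑ n ∈ Finset.Icc 1 ⌊2 * P4 D⌋₊,
        κs m * as n * x.ψ (m : ZMod x.p) * conj (x.ψ (n : ZMod x.p)) / (n : ℂ) *
          Lemma53.Delta1_56 (ell2 D) (t0 D) ((m : ℝ) / ((D : ℝ) * x.p * n)) = F x.p x.ψ := by
    intro x
    rw [hF]
    simp only
    rw [psiChi, tauSum_eq_tau]
  rw [Finset.sum_congr rfl fun x _ => hmain x, sum_finsetOf_p_eq hp F]
  -- Step 2: `(χψ)⁻¹ = χψ̄` lifted, and the character sum inside
  have hinv : ∀ ψ : DirichletCharacter ℂ p,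
      (DirichletCharacter.changeLevel (dvd_mul_right D p) χ *
          DirichletCharacter.changeLevel (dvd_mul_left p D) ψ)⁻¹ =
        DirichletCharacter.changeLevel (dvd_mul_right D p) χ *
          DirichletCharacter.changeLevel (dvd_mul_left p D) ψ⁻¹ := by
    intro ψ
    rw [mul_inv, ← map_inv, ← map_inv, hq.inv]
  have hFp : ∀ ψ : DirichletCharacter ℂ p, F p ψ = ((D : ℂ) * p)⁻¹ *
      (tauSum (D * p) (DirichletCharacter.changeLevel (dvd_mul_right D p) χ *
          DirichletCharacter.changeLevel (dvd_mul_left p D) ψ⁻¹) *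
        ∑' m : ℕ, ∑ n ∈ Finset.Icc 1 ⌊2 * P4 D⌋₊,
          κs m * as n * ψ (m : ZMod p) * conj (ψ (n : ZMod p)) / (n : ℂ) *
            Lemma53.Delta1_56 (ell2 D) (t0 D) ((m : ℝ) / ((D : ℝ) * p * n))) := by
    intro ψ
    rw [hF]
    simp only
    rw [hinv]
    ring
  rw [Finset.sum_congr rfl fun ψ _ => hFp ψ, ← Finset.mul_sum,
    sum_char_tsum_exchange hD hκ as ⌊2 * P4 D⌋₊]

end MainTerm

/-! ## The coefficient of the difference `main term of Σ*Ĩ₂ − target`, pointwise -/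

/-- Pointwise size of the discrepancy between `W(m,n)/(Dp)` (`W` = the non-principal character sum) and
the target coefficient `τ(χ)χ(p)e(mD̄n̄/p)/D`: `≤ 2/(p√D) + [p ∣ m]/√D` (`|τ(χ)| = |τ(χψ⁰_p)| = √D`).
[cite: Zhang2022LandauSiegel, §14 u006 p.77] -/
theorem norm_coeff_sub_le {D p m : ℕ} (hD : 0 < D) (hp : 0 < p) {τ τ₀ χp e : ℂ}
    (hτ : ‖τ‖ = Real.sqrt D) (hτ₀ : ‖τ₀‖ = Real.sqrt D) (hχp : ‖χp‖ ≤ 1) (he : ‖e‖ = 1) :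
    ‖(if p ∣ m then (0 : ℂ) else τ * χp * ((p : ℂ) - 1) * e - τ₀) / ((D : ℂ) * p) - τ * χp / D * e‖ ≤
      2 / ((p : ℝ) * Real.sqrt D) + (if p ∣ m then 1 / Real.sqrt D else 0) := by
  have hD0 : (0 : ℝ) < D := by exact_mod_cast hD
  have hp0 : (0 : ℝ) < p := by exact_mod_cast hp
  have hsD : 0 < Real.sqrt D := Real.sqrt_pos.mpr hD0
  have hsqD : Real.sqrt D * Real.sqrt D = D := Real.mul_self_sqrt hD0.le
  have hτχ : ‖τ * χp‖ ≤ Real.sqrt D := by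
    rw [norm_mul, hτ]; nlinarith [norm_nonneg χp]
  split_ifs with hpm
  · -- `p ∣ m`: the coefficient is `-τχ(p)e/D`
    rw [zero_div, zero_sub, norm_neg, norm_mul, norm_div, he, mul_one, Complex.norm_natCast]
    have h1 : ‖τ * χp‖ / (D : ℝ) ≤ Real.sqrt D / D := by gcongr
    have h2 : Real.sqrt D / D = 1 / Real.sqrt D := by
      rw [div_eq_div_iff hD0.ne' hsD.ne', one_mul, hsqD]
    have h3 : 0 ≤ 2 / ((p : ℝ) * Real.sqrt D) := by positivity
    linarith
  · -- `p ∤ m`: the coefficient is `-(τχ(p)e + τ₀)/(Dp)`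
    rw [add_zero]
    have hid : (τ * χp * ((p : ℂ) - 1) * e - τ₀) / ((D : ℂ) * p) - τ * χp / D * e =
        -(τ * χp * e + τ₀) / ((D : ℂ) * p) := by
      have hD' : (D : ℂ) ≠ 0 := by exact_mod_cast hD.ne'
      have hp' : (p : ℂ) ≠ 0 := by exact_mod_cast hp.ne'
      field_simp
      ring
    rw [hid, norm_div, norm_neg, norm_mul, Complex.norm_natCast, Complex.norm_natCast]
    have h1 : ‖τ * χp * e + τ₀‖ ≤ 2 * Real.sqrt D := by
      refine (norm_add_le _ _).trans ?_
      rw [norm_mul, he, mul_one, hτ₀]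
      linarith
    rw [div_le_div_iff₀ (by positivity) (by positivity)]
    calc ‖τ * χp * e + τ₀‖ * ((p : ℝ) * Real.sqrt D) ≤ 2 * Real.sqrt D * ((p : ℝ) * Real.sqrt D) := by
          gcongr
      _ = 2 * ((D : ℝ) * p) := by rw [mul_comm (p : ℝ), ← mul_assoc, mul_assoc 2, hsqD]; ring

/-! ## The `p ∣ m` part of a divisor-weighted `Δ`-series -/

/-- `d(pm) ≤ 2d(m)` for a prime `p` (`d` submultiplicative, `d(p) = 2`). [folklore] -/
private theorem card_divisors_prime_mul_le {p : ℕ} (hp : p.Prime) (m : ℕ) :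
    (p * m).divisors.card ≤ 2 * m.divisors.card := by
  calc (p * m).divisors.card ≤ p.divisors.card * m.divisors.card := by
        rw [Nat.divisors_mul]; exact Finset.card_mul_le
    _ = 2 * m.divisors.card := by rw [Nat.Prime.divisors hp, Finset.card_pair hp.one_lt.ne]

/-- **The multiples of `p`**: `Σ_{p∣m} d(m)⁴‖Δ(m/(pX))‖ ≤ 16 Σ_{m'} d(m')⁴‖Δ(m'/X)‖` (reindex `m = pm'`,
`d(pm') ≤ 2d(m')`), given the summability of the right-hand series. [cite: Zhang2022LandauSiegel, §14 u006 p.77] -/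
theorem tsum_dvd_divisors_pow_mul_norm_DeltaW_le {D p : ℕ} (hp : p.Prime) {X : ℝ} (hX : 0 < X)
    (hs : Summable fun m : ℕ => (m.divisors.card : ℝ) ^ 4 * ‖DeltaW D ((m : ℝ) / X)‖) :
    Summable (fun m : ℕ => if p ∣ m then (m.divisors.card : ℝ) ^ 4 * ‖DeltaW D ((m : ℝ) / (p * X))‖ else 0) ∧
    (∑' m : ℕ, (if p ∣ m then (m.divisors.card : ℝ) ^ 4 * ‖DeltaW D ((m : ℝ) / (p * X))‖ else 0)) ≤
      16 * ∑' m : ℕ, (m.divisors.card : ℝ) ^ 4 * ‖DeltaW D ((m : ℝ) / X)‖ := by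
  have hp0 : p ≠ 0 := hp.ne_zero
  have hp0' : (p : ℝ) ≠ 0 := by exact_mod_cast hp0
  set F : ℕ → ℝ := fun m => if p ∣ m then (m.divisors.card : ℝ) ^ 4 * ‖DeltaW D ((m : ℝ) / (p * X))‖
    else 0 with hF
  have hinj : Function.Injective (fun m' : ℕ => p * m') := mul_right_injective₀ hp0
  have hsupp : Function.support F ⊆ Set.range (fun m' : ℕ => p * m') := by
    intro m hm
    rw [Function.mem_support] at hm
    simp only [hF] at hm
    by_cases h : p ∣ m
    · obtain ⟨m', rfl⟩ := h; exact ⟨m', rfl⟩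
    · rw [if_neg h] at hm; exact absurd rfl hm
  -- the reindexed series and its termwise bound
  have hcomp : ∀ m' : ℕ, F (p * m') ≤ 16 * ((m'.divisors.card : ℝ) ^ 4 * ‖DeltaW D ((m' : ℝ) / X)‖) := by
    intro m'
    simp only [hF, if_pos (dvd_mul_right p m')]
    have harg : ((p * m' : ℕ) : ℝ) / (p * X) = (m' : ℝ) / X := by
      push_cast; field_simp
    rw [harg]
    have hd : ((p * m').divisors.card : ℝ) ≤ 2 * m'.divisors.card := by
      exact_mod_cast card_divisors_prime_mul_le hp m'
    have h0 : 0 ≤ ((p * m').divisors.card : ℝ) := by positivity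
    calc ((p * m').divisors.card : ℝ) ^ 4 * ‖DeltaW D ((m' : ℝ) / X)‖
        ≤ (2 * m'.divisors.card) ^ 4 * ‖DeltaW D ((m' : ℝ) / X)‖ := by gcongr
      _ = 16 * ((m'.divisors.card : ℝ) ^ 4 * ‖DeltaW D ((m' : ℝ) / X)‖) := by ring
  have hF0 : ∀ m, 0 ≤ F m := fun m => by simp only [hF]; split_ifs <;> positivity
  have hsum' : Summable (fun m' : ℕ => F (p * m')) :=
    Summable.of_nonneg_of_le (fun m' => hF0 _) hcomp (hs.mul_left 16)
  have hzero : ∀ x ∉ Set.range (fun m' : ℕ => p * m'), F x = 0 := fun x hx => by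
    by_contra h
    exact hx (hsupp (Function.mem_support.mpr h))
  have hFs : Summable F := (Function.Injective.summable_iff hinj hzero).mp hsum'
  refine ⟨hFs, ?_⟩
  rw [← hinj.tsum_eq hsupp]
  calc ∑' m' : ℕ, F (p * m') ≤ ∑' m' : ℕ, 16 * ((m'.divisors.card : ℝ) ^ 4 * ‖DeltaW D ((m' : ℝ) / X)‖) :=
        hsum'.tsum_le_tsum hcomp (hs.mul_left 16)
    _ = 16 * ∑' m' : ℕ, (m'.divisors.card : ℝ) ^ 4 * ‖DeltaW D ((m' : ℝ) / X)‖ := tsum_mul_left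


/-! ## Arithmetic helpers (`τ₅ ≤ d⁴`, `d(pm) ≤ 2d(m)`; private copies of the helpers of
`Section14Majorant1413`) -/

/-- `τ_{j+1}(n) ≤ d(n)^j`. [folklore] -/
private theorem zeta_pow_succ_apply_le_card_divisors_pow (j : ℕ) {n : ℕ} (hn : n ≠ 0) :
    (ArithmeticFunction.zeta ^ (j + 1) : ArithmeticFunction ℕ) n ≤ n.divisors.card ^ j := by
  induction j generalizing n with
  | zero =>
      rw [zero_add, pow_one, ArithmeticFunction.zeta_apply, if_neg hn, pow_zero]
  | succ j ih =>
      rw [pow_succ, ArithmeticFunction.mul_zeta_apply]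
      calc ∑ i ∈ n.divisors, (ArithmeticFunction.zeta ^ (j + 1) : ArithmeticFunction ℕ) i
          ≤ ∑ i ∈ n.divisors, n.divisors.card ^ j := by
            refine Finset.sum_le_sum fun i hi => ?_
            have hi0 : i ≠ 0 := Nat.pos_iff_ne_zero.mp (Nat.pos_of_mem_divisors hi)
            refine (ih hi0).trans (Nat.pow_le_pow_left ?_ j)
            exact Finset.card_le_card (Nat.divisors_subset_of_dvd hn (Nat.dvd_of_mem_divisors hi))
        _ = n.divisors.card ^ (j + 1) := by rw [Finset.sum_const, smul_eq_mul, pow_succ']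

/-- `τ₅(n) ≤ d(n)⁴` (as reals). [folklore] -/
private theorem zeta_pow_five_le_card_divisors_pow_four (n : ℕ) :
    (((ArithmeticFunction.zeta ^ 5 : ArithmeticFunction ℕ) n : ℕ) : ℝ) ≤ (n.divisors.card : ℝ) ^ 4 := by
  rcases eq_or_ne n 0 with rfl | hn
  · simp
  · exact_mod_cast zeta_pow_succ_apply_le_card_divisors_pow 4 hn

/-- Under (14.1) (with `B ≥ 0`), `|κ*(m)| ≤ B·d(m)⁴`. [cite: Zhang2022LandauSiegel, §14 (14.1) p.76] -/
private theorem norm_kappa_le_divisors {B : ℝ} (hB0 : 0 ≤ B) {κs : ℕ → ℂ} (h141 : Eq141 B κs)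
    (m : ℕ) : ‖κs m‖ ≤ B * (m.divisors.card : ℝ) ^ 4 :=
  (h141 m).trans (mul_le_mul_of_nonneg_left (zeta_pow_five_le_card_divisors_pow_four m) hB0)

/-- `|e(y)| = 1`. [folklore] -/
private theorem norm_eAdd_one (y : ℝ) : ‖eAdd y‖ = 1 := by
  rw [eAdd, show (2 : ℂ) * π * I * y = ((2 * π * y : ℝ) : ℂ) * I by push_cast; ring,
    Complex.norm_exp_ofReal_mul_I]

/-- Re-indexing a real series over the multiples of `p ≥ 1`:
`Σ_m [p ∣ m] h(m) = Σ_k h(pk)`. [folklore] -/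
private theorem tsum_ite_dvd_eq_tsum_mul {p : ℕ} (hp : 0 < p) (h : ℕ → ℝ) :
    ∑' m : ℕ, (if p ∣ m then h m else 0) = ∑' k : ℕ, h (p * k) := by
  have hinj : Function.Injective (fun k : ℕ => p * k) := fun a b hab =>
    Nat.eq_of_mul_eq_mul_left hp hab
  have hsupp : Function.support (fun m : ℕ => if p ∣ m then h m else 0) ⊆
      Set.range (fun k : ℕ => p * k) := by
    intro m hm
    have hm' : (if p ∣ m then h m else 0) ≠ 0 := hm
    by_cases hpm : p ∣ m
    · obtain ⟨k, hk⟩ := hpm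
      exact ⟨k, hk.symm⟩
    · rw [if_neg hpm] at hm'
      exact absurd rfl hm'
  calc ∑' m : ℕ, (if p ∣ m then h m else 0)
      = ∑' k : ℕ, (if p ∣ p * k then h (p * k) else 0) :=
        (hinj.tsum_eq (f := fun m : ℕ => if p ∣ m then h m else 0) hsupp).symm
    _ = ∑' k : ℕ, h (p * k) := tsum_congr fun k => by rw [if_pos (dvd_mul_right p k)]

/-- `#{x ∈ Ψ : p_x = p} ≤ p` (the primitive characters mod a window prime are the `p − 2`
non-principal ones). [cite: Zhang2022LandauSiegel, §2 p.4] -/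
theorem card_finsetOf_p_le {D p : ℕ} (hp : p ∈ primeWindow D) :
    ((finsetOf {x : Chr D | x.p = p}).card : ℝ) ≤ p := by
  classical
  have hP : p.Prime := (Finset.mem_filter.mp hp).2
  haveI : Fact p.Prime := ⟨hP⟩
  haveI : NeZero p := ⟨hP.ne_zero⟩
  have h := Skeleton.sum_finsetOf_p_eq hp (fun _ _ => (1 : ℂ))
  rw [Finset.sum_const, Finset.sum_const, nsmul_eq_mul, nsmul_eq_mul, mul_one, mul_one] at h
  have h1 : (finsetOf {x : Chr D | x.p = p}).card =
      ((Finset.univ : Finset (DirichletCharacter ℂ p)).erase 1).card := by exact_mod_cast h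
  have hcard : Fintype.card (DirichletCharacter ℂ p) = p - 1 := by
    rw [← Nat.card_eq_fintype_card,
      DirichletCharacter.card_eq_totient_of_hasEnoughRootsOfUnity ℂ p, Nat.totient_prime hP]
  have h2 : ((Finset.univ : Finset (DirichletCharacter ℂ p)).erase 1).card ≤ p :=
    calc ((Finset.univ : Finset (DirichletCharacter ℂ p)).erase 1).card
        ≤ (Finset.univ : Finset (DirichletCharacter ℂ p)).card := Finset.card_erase_le
      _ = p - 1 := by rw [Finset.card_univ, hcard]
      _ ≤ p := Nat.sub_le p 1
  rw [h1]
  exact_mod_cast h2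

/-! ## The main terms minus the target: `≪ √D·𝓛⁶⁷⁴·P₄` -/

/-- **The discrepancy between the summed u004 main terms and the target of u006 (first line)**:
with `W(m,n) = [p ∤ m](τ(χ)χ(p)(p−1)e_{m,n} − τ(χψ⁰))` (`(n,p) = 1`) and `|τ(χ)| = |τ(χψ⁰)| = √D`,
`‖(Dp)⁻¹ΣΣ κ*(m)a*(n)n⁻¹Δ₁W − τ(χ)χ(p)D⁻¹ΣΣ κ*(m)a*(n)n⁻¹Δ₁e‖ ≤ 18B²K_W√D𝓛⁶⁷⁴·N`
(`K_W = (2C+3)7¹⁶ + 4C` the window-lemma constant of Lemma 5.3): pointwise the coefficient is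
`≤ 2/(p√D) + [p ∣ m]/√D` (`norm_coeff_sub_le`); the first part is summed with the window lemma at
`X = Dpn`, the `p ∣ m` sub-series, re-indexed `m = pk` (`d(pk) ≤ 2d(k)`), at `X = Dn`.
[cite: Zhang2022LandauSiegel, §14 u006 p.77; §5 Lemma 5.3 p.25] -/
theorem norm_mainTerms_sub_target_le {D : ℕ} [NeZero D] {c C : ℝ} (hc : 0 ≤ c) (hC : 0 ≤ C)
    (hℓ3 : 3 ≤ ell D)
    (h53 : ∀ x : ℝ, 0 < x →
      (x ≤ t0 D ^ (1.02 : ℝ) → ‖DeltaW D x - omegaW D (1 / 2 + 2 * π * x * I)‖ ≤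
          C * alpha D * ‖omegaW D (1 / 2 + 2 * π * x * I)‖ + Real.exp (-c * ell D ^ 10)) ∧
      (t0 D ^ (1.02 : ℝ) < x → ‖DeltaW D x‖ ≤
        C * (Real.exp (-((1 : ℝ) / 100 * ell2 D * Real.log x) ^ 2) +
          Real.exp (-(x ^ (0.99 : ℝ)) / ell2 D))))
    {B : ℝ} (hB0 : 0 ≤ B) {κs as : ℕ → ℂ} (h141 : Eq141 B κs) (h142 : Eq142 D B as)
    {p : ℕ} (hp : p.Prime) (hp2P : (p : ℝ) < 2 * bigP D) {N : ℕ} (hNP : (N : ℝ) ≤ bigP D)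
    {τ τ₀ χp : ℂ} (hτ : ‖τ‖ = Real.sqrt D) (hτ₀ : ‖τ₀‖ = Real.sqrt D) (hχp : ‖χp‖ ≤ 1)
    (e : ℕ → ℕ → ℝ) (W : ℕ → ℕ → ℂ)
    (hW : ∀ m : ℕ, ∀ n ∈ Finset.Icc 1 N, W m n =
      if p ∣ m then 0 else τ * χp * ((p : ℂ) - 1) * eAdd (e m n) - τ₀) :
    ‖((D : ℂ) * p)⁻¹ * ∑' m : ℕ, ∑ n ∈ Finset.Icc 1 N, κs m * as n / (n : ℂ) *
          Lemma53.Delta1_56 (ell2 D) (t0 D) ((m : ℝ) / ((D : ℝ) * p * n)) * W m n -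
        τ * χp / D * ∑' m : ℕ, ∑ n ∈ Finset.Icc 1 N, κs m * as n / (n : ℂ) *
          Lemma53.Delta1_56 (ell2 D) (t0 D) ((m : ℝ) / ((D : ℝ) * p * n)) * eAdd (e m n)‖ ≤
      18 * B ^ 2 * ((2 * C + 3) * 7 ^ 16 + 4 * C) * Real.sqrt D * ell D ^ 674 * N := by
  have hℓ1 : 1 ≤ ell D := by linarith
  have hD0 : (0 : ℝ) < D := by exact_mod_cast Nat.pos_of_ne_zero (NeZero.ne D)
  have hD1 : (1 : ℝ) ≤ D := by exact_mod_cast Nat.pos_of_ne_zero (NeZero.ne D)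
  have hDpos : 0 < D := Nat.pos_of_ne_zero (NeZero.ne D)
  have hsD : 0 < Real.sqrt D := Real.sqrt_pos.mpr hD0
  have hsqD : Real.sqrt D * Real.sqrt D = D := Real.mul_self_sqrt hD0.le
  have hp0 : (0 : ℝ) < p := by exact_mod_cast hp.pos
  have hp0' : (p : ℝ) ≠ 0 := hp0.ne'
  have hD0' : (D : ℝ) ≠ 0 := hD0.ne'
  have hsD' : Real.sqrt D ≠ 0 := hsD.ne'
  have hp1 : (1 : ℝ) ≤ p := by exact_mod_cast hp.one_lt.le
  have hP0 : 0 < bigP D := Real.exp_pos _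
  have hlogP : Real.log (bigP D) = ell D ^ 9 := by rw [bigP, Real.log_exp]
  set K : ℝ := (2 * C + 3) * 7 ^ 16 + 4 * C with hK
  have hK0 : 0 ≤ K := by rw [hK]; positivity
  -- window data at `X = Dpn` and `X = Dn`
  have hwin : ∀ n ∈ Finset.Icc 1 N,
      ((Summable (fun m : ℕ => (m.divisors.card : ℝ) ^ 4 *
          ‖DeltaW D ((m : ℝ) / ((D : ℝ) * p * n))‖)) ∧
        ∑' m : ℕ, (m.divisors.card : ℝ) ^ 4 * ‖DeltaW D ((m : ℝ) / ((D : ℝ) * p * n))‖ ≤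
          K * ((D : ℝ) * p * n) * ell D ^ 674) ∧
      ((Summable (fun m : ℕ => (m.divisors.card : ℝ) ^ 4 *
          ‖DeltaW D ((m : ℝ) / ((D : ℝ) * n))‖)) ∧
        ∑' m : ℕ, (m.divisors.card : ℝ) ^ 4 * ‖DeltaW D ((m : ℝ) / ((D : ℝ) * n))‖ ≤
          K * ((D : ℝ) * n) * ell D ^ 674) := by
    intro n hn
    obtain ⟨hn1, hnN⟩ := Finset.mem_Icc.mp hn
    have hn0 : (0 : ℝ) < n := by exact_mod_cast hn1
    have hn1r : (1 : ℝ) ≤ n := by exact_mod_cast hn1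
    have hnP : (n : ℝ) ≤ bigP D := le_trans (by exact_mod_cast hnN) hNP
    have hlogn : Real.log n ≤ ell D ^ 9 := by rw [← hlogP]; exact Real.log_le_log hn0 hnP
    have hlogp : Real.log p ≤ Real.log 2 + ell D ^ 9 := by
      rw [← hlogP, ← Real.log_mul (by norm_num) hP0.ne']
      exact Real.log_le_log hp0 hp2P.le
    have hlog2 : Real.log 2 ≤ 1 := by
      have := Real.log_two_lt_d9; linarith
    have h9 : ell D ≤ ell D ^ 9 := le_self_pow₀ hℓ1 (by norm_num)
    have h91 : (1 : ℝ) ≤ ell D ^ 9 := one_le_pow₀ hℓ1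
    have hlogD : Real.log D = ell D := rfl
    have hX1 : (1 : ℝ) ≤ (D : ℝ) * p * n :=
      one_le_mul_of_one_le_of_one_le (one_le_mul_of_one_le_of_one_le hD1 hp1) hn1r
    have hY1 : (1 : ℝ) ≤ (D : ℝ) * n := one_le_mul_of_one_le_of_one_le hD1 hn1r
    have hlogX : Real.log ((D : ℝ) * p * n) ≤ 5 * ell D ^ 9 := by
      rw [Real.log_mul (by positivity) hn0.ne', Real.log_mul hD0.ne' hp0.ne', hlogD]
      linarith
    have hlogY : Real.log ((D : ℝ) * n) ≤ 5 * ell D ^ 9 := by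
      rw [Real.log_mul hD0.ne' hn0.ne', hlogD]
      linarith
    exact ⟨tsum_divisors_pow_mul_norm_DeltaW_le hc hC hℓ3 h53 hX1 hlogX,
      tsum_divisors_pow_mul_norm_DeltaW_le hc hC hℓ3 h53 hY1 hlogY⟩
  -- `‖a*(n)‖/n ≤ B` on the range
  have hasn : ∀ n ∈ Finset.Icc 1 N, ‖as n‖ / n ≤ B := by
    intro n hn
    obtain ⟨hn1, _⟩ := Finset.mem_Icc.mp hn
    exact (div_le_self (norm_nonneg _) (by exact_mod_cast hn1)).trans (h142.1 n)
  -- complex summability of the `n`-pieces with any bounded weight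
  have hdom : ∀ n ∈ Finset.Icc 1 N, ∀ (g : ℕ → ℂ) (Gb : ℝ), (∀ m, ‖g m‖ ≤ Gb) →
      Summable (fun m : ℕ => κs m * as n / (n : ℂ) *
        Lemma53.Delta1_56 (ell2 D) (t0 D) ((m : ℝ) / ((D : ℝ) * p * n)) * g m) := by
    intro n hn g Gb hg
    obtain ⟨hn1, _⟩ := Finset.mem_Icc.mp hn
    have hGb : 0 ≤ Gb := (norm_nonneg _).trans (hg 0)
    have hb : 0 ≤ ‖as n‖ / n := by positivity
    refine Summable.of_norm_bounded (g := fun m : ℕ => (B * B * Gb) *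
      ((m.divisors.card : ℝ) ^ 4 * ‖DeltaW D ((m : ℝ) / ((D : ℝ) * p * n))‖))
      ((hwin n hn).1.1.mul_left _) (fun m => ?_)
    rw [norm_mul, norm_mul, norm_div, norm_mul, Complex.norm_natCast, norm_Delta1_eq]
    have h1 : ‖κs m‖ ≤ B * (m.divisors.card : ℝ) ^ 4 := norm_kappa_le_divisors hB0 h141 m
    have h2 : ‖as n‖ / n ≤ B := hasn n hn
    have h3 := hg m
    have hδ0 : 0 ≤ ‖DeltaW D ((m : ℝ) / ((D : ℝ) * p * n))‖ := norm_nonneg _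
    have h12 : ‖κs m‖ * (‖as n‖ / n) ≤ B * (m.divisors.card : ℝ) ^ 4 * B :=
      mul_le_mul h1 h2 hb (mul_nonneg hB0 (by positivity))
    have h123 : ‖κs m‖ * (‖as n‖ / n) * ‖DeltaW D ((m : ℝ) / ((D : ℝ) * p * n))‖ * ‖g m‖ ≤
        B * (m.divisors.card : ℝ) ^ 4 * B * ‖DeltaW D ((m : ℝ) / ((D : ℝ) * p * n))‖ * Gb :=
      mul_le_mul (mul_le_mul_of_nonneg_right h12 hδ0) h3 (norm_nonneg _)
        (mul_nonneg (mul_nonneg (mul_nonneg hB0 (by positivity)) hB0) hδ0)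
    calc ‖κs m‖ * ‖as n‖ / n * ‖DeltaW D ((m : ℝ) / ((D : ℝ) * p * n))‖ * ‖g m‖
        = ‖κs m‖ * (‖as n‖ / n) * ‖DeltaW D ((m : ℝ) / ((D : ℝ) * p * n))‖ * ‖g m‖ := by ring
      _ ≤ B * (m.divisors.card : ℝ) ^ 4 * B * ‖DeltaW D ((m : ℝ) / ((D : ℝ) * p * n))‖ * Gb := h123
      _ = B * B * Gb * ((m.divisors.card : ℝ) ^ 4 * ‖DeltaW D ((m : ℝ) / ((D : ℝ) * p * n))‖) := by
          ring
  -- a bound for `W`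
  have hWb : ∀ m : ℕ, ∀ n ∈ Finset.Icc 1 N,
      ‖W m n‖ ≤ Real.sqrt D * ‖(p : ℂ) - 1‖ + Real.sqrt D := by
    intro m n hn
    rw [hW m n hn]
    split_ifs with hpm
    · rw [norm_zero]; positivity
    · calc ‖τ * χp * ((p : ℂ) - 1) * eAdd (e m n) - τ₀‖
          ≤ ‖τ * χp * ((p : ℂ) - 1) * eAdd (e m n)‖ + ‖τ₀‖ := norm_sub_le _ _
        _ = Real.sqrt D * ‖χp‖ * ‖(p : ℂ) - 1‖ + Real.sqrt D := by
            rw [norm_mul, norm_mul, norm_mul, norm_eAdd_one, mul_one, hτ, hτ₀]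
        _ ≤ Real.sqrt D * 1 * ‖(p : ℂ) - 1‖ + Real.sqrt D := by gcongr
        _ = Real.sqrt D * ‖(p : ℂ) - 1‖ + Real.sqrt D := by rw [mul_one]
  -- summability of the two `m`-series
  have hSW : Summable (fun m : ℕ => ∑ n ∈ Finset.Icc 1 N, κs m * as n / (n : ℂ) *
      Lemma53.Delta1_56 (ell2 D) (t0 D) ((m : ℝ) / ((D : ℝ) * p * n)) * W m n) :=
    summable_sum fun n hn => hdom n hn (fun m => W m n) _ (fun m => hWb m n hn)
  have hSe : Summable (fun m : ℕ => ∑ n ∈ Finset.Icc 1 N, κs m * as n / (n : ℂ) *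
      Lemma53.Delta1_56 (ell2 D) (t0 D) ((m : ℝ) / ((D : ℝ) * p * n)) * eAdd (e m n)) :=
    summable_sum fun n hn => hdom n hn (fun m => eAdd (e m n)) 1 (fun m => (norm_eAdd_one _).le)
  -- the combined series
  set F : ℕ → ℂ := fun m => ∑ n ∈ Finset.Icc 1 N, κs m * as n / (n : ℂ) *
      Lemma53.Delta1_56 (ell2 D) (t0 D) ((m : ℝ) / ((D : ℝ) * p * n)) *
        ((if p ∣ m then 0 else τ * χp * ((p : ℂ) - 1) * eAdd (e m n) - τ₀) / ((D : ℂ) * p) -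
          τ * χp / D * eAdd (e m n)) with hFdef
  have hdiff : ((D : ℂ) * p)⁻¹ * ∑' m : ℕ, ∑ n ∈ Finset.Icc 1 N, κs m * as n / (n : ℂ) *
          Lemma53.Delta1_56 (ell2 D) (t0 D) ((m : ℝ) / ((D : ℝ) * p * n)) * W m n -
        τ * χp / D * ∑' m : ℕ, ∑ n ∈ Finset.Icc 1 N, κs m * as n / (n : ℂ) *
          Lemma53.Delta1_56 (ell2 D) (t0 D) ((m : ℝ) / ((D : ℝ) * p * n)) * eAdd (e m n) =
      ∑' m : ℕ, F m := by
    rw [← tsum_mul_left, ← tsum_mul_left, ← Summable.tsum_sub (hSW.mul_left _) (hSe.mul_left _)]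
    refine tsum_congr fun m => ?_
    rw [hFdef]
    beta_reduce
    rw [Finset.mul_sum, Finset.mul_sum, ← Finset.sum_sub_distrib]
    refine Finset.sum_congr rfl fun n hn => ?_
    rw [hW m n hn]
    ring
  -- the real majorants
  set A : ℕ → ℕ → ℝ := fun n m => ‖κs m‖ * ‖as n‖ / n *
      ‖DeltaW D ((m : ℝ) / ((D : ℝ) * p * n))‖ * (2 / ((p : ℝ) * Real.sqrt D)) with hAdef
  set Bf : ℕ → ℕ → ℝ := fun n m => if p ∣ m then ‖κs m‖ * ‖as n‖ / n *
      ‖DeltaW D ((m : ℝ) / ((D : ℝ) * p * n))‖ * (1 / Real.sqrt D) else 0 with hBdef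
  set G : ℕ → ℝ := fun m => ∑ n ∈ Finset.Icc 1 N, (A n m + Bf n m) with hGdef
  have hFG : ∀ m, ‖F m‖ ≤ G m := by
    intro m
    simp only [hFdef, hGdef]
    refine (norm_sum_le _ _).trans (Finset.sum_le_sum fun n hn => ?_)
    obtain ⟨hn1, _⟩ := Finset.mem_Icc.mp hn
    have hcoef := norm_coeff_sub_le (m := m) hDpos hp.pos hτ hτ₀ hχp (norm_eAdd_one (e m n))
    rw [norm_mul, norm_mul, norm_div, norm_mul, Complex.norm_natCast, norm_Delta1_eq]
    have hX0 : 0 ≤ ‖κs m‖ * ‖as n‖ / n * ‖DeltaW D ((m : ℝ) / ((D : ℝ) * p * n))‖ := by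
      positivity
    refine (mul_le_mul_of_nonneg_left hcoef hX0).trans (le_of_eq ?_)
    simp only [hAdef, hBdef]
    split_ifs <;> ring
  -- the `A`-series at fixed `n`
  have hA : ∀ n ∈ Finset.Icc 1 N, Summable (A n) ∧
      ∑' m, A n m ≤ 2 * B ^ 2 * K * Real.sqrt D * ell D ^ 674 := by
    intro n hn
    obtain ⟨hn1, _⟩ := Finset.mem_Icc.mp hn
    have hn0 : (0 : ℝ) < n := by exact_mod_cast hn1
    obtain ⟨⟨hsumX, hwinX⟩, _⟩ := hwin n hn
    have hb : 0 ≤ ‖as n‖ / n := by positivity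
    set cA : ℝ := ‖as n‖ / n * (2 / ((p : ℝ) * Real.sqrt D)) with hcA
    have hcA0 : 0 ≤ cA := by rw [hcA]; positivity
    have hle : ∀ m, A n m ≤ cA * B * ((m.divisors.card : ℝ) ^ 4 *
        ‖DeltaW D ((m : ℝ) / ((D : ℝ) * p * n))‖) := by
      intro m
      have h1 : ‖κs m‖ ≤ B * (m.divisors.card : ℝ) ^ 4 := norm_kappa_le_divisors hB0 h141 m
      have hδ0 : 0 ≤ ‖DeltaW D ((m : ℝ) / ((D : ℝ) * p * n))‖ := norm_nonneg _
      calc A n m = cA * (‖κs m‖ * ‖DeltaW D ((m : ℝ) / ((D : ℝ) * p * n))‖) := by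
            simp only [hAdef, hcA]; ring
        _ ≤ cA * (B * (m.divisors.card : ℝ) ^ 4 * ‖DeltaW D ((m : ℝ) / ((D : ℝ) * p * n))‖) :=
            mul_le_mul_of_nonneg_left (mul_le_mul_of_nonneg_right h1 hδ0) hcA0
        _ = cA * B * ((m.divisors.card : ℝ) ^ 4 * ‖DeltaW D ((m : ℝ) / ((D : ℝ) * p * n))‖) := by
            ring
    have hA0 : ∀ m, 0 ≤ A n m := fun m => by simp only [hAdef]; positivity
    have hmaj : Summable (fun m : ℕ => cA * B * ((m.divisors.card : ℝ) ^ 4 *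
        ‖DeltaW D ((m : ℝ) / ((D : ℝ) * p * n))‖)) := hsumX.mul_left _
    have hsA : Summable (A n) := Summable.of_nonneg_of_le hA0 hle hmaj
    refine ⟨hsA, ?_⟩
    have hkey : 2 / ((p : ℝ) * Real.sqrt D) * ((D : ℝ) * p * n) = 2 * Real.sqrt D * n := by
      rw [div_mul_eq_mul_div, div_eq_iff (by positivity : (p : ℝ) * Real.sqrt D ≠ 0)]
      linear_combination (2 * (p : ℝ) * (n : ℝ)) * hsqD.symm
    have hn0' : (n : ℝ) ≠ 0 := hn0.ne'
    calc ∑' m : ℕ, A n m ≤ ∑' m : ℕ, cA * B * ((m.divisors.card : ℝ) ^ 4 *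
          ‖DeltaW D ((m : ℝ) / ((D : ℝ) * p * n))‖) := hsA.tsum_le_tsum hle hmaj
      _ = cA * B * ∑' m : ℕ, (m.divisors.card : ℝ) ^ 4 *
          ‖DeltaW D ((m : ℝ) / ((D : ℝ) * p * n))‖ := tsum_mul_left
      _ ≤ cA * B * (K * ((D : ℝ) * p * n) * ell D ^ 674) :=
          mul_le_mul_of_nonneg_left hwinX (mul_nonneg hcA0 hB0)
      _ = ‖as n‖ / n * B * K * ell D ^ 674 * (2 / ((p : ℝ) * Real.sqrt D) * ((D : ℝ) * p * n)) := by
          rw [hcA]; ring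
      _ = 2 * ‖as n‖ * B * K * Real.sqrt D * ell D ^ 674 * ((n : ℝ) / n) := by
          rw [hkey]; ring
      _ = 2 * ‖as n‖ * B * K * Real.sqrt D * ell D ^ 674 := by rw [div_self hn0', mul_one]
      _ = ‖as n‖ * (2 * B * K * Real.sqrt D * ell D ^ 674) := by ring
      _ ≤ B * (2 * B * K * Real.sqrt D * ell D ^ 674) :=
          mul_le_mul_of_nonneg_right (h142.1 n)
            (mul_nonneg (mul_nonneg (mul_nonneg (mul_nonneg (by norm_num) hB0) hK0) hsD.le)
              (by positivity))
      _ = 2 * B ^ 2 * K * Real.sqrt D * ell D ^ 674 := by ring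
  -- the `p ∣ m` series at fixed `n`
  have hB : ∀ n ∈ Finset.Icc 1 N, Summable (Bf n) ∧
      ∑' m, Bf n m ≤ 16 * B ^ 2 * K * Real.sqrt D * ell D ^ 674 := by
    intro n hn
    obtain ⟨hn1, _⟩ := Finset.mem_Icc.mp hn
    have hn0 : (0 : ℝ) < n := by exact_mod_cast hn1
    have hn0' : (n : ℝ) ≠ 0 := hn0.ne'
    obtain ⟨_, ⟨hsumY, hwinY⟩⟩ := hwin n hn
    have hb : 0 ≤ ‖as n‖ / n := by positivity
    -- summability from `Bf ≤ A·(p/2)`-type domination by the `A`-series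
    have hBA : ∀ m, Bf n m ≤ ((p : ℝ) / 2) * A n m := by
      intro m
      simp only [hBdef, hAdef]
      have hX0 : 0 ≤ ‖κs m‖ * ‖as n‖ / n * ‖DeltaW D ((m : ℝ) / ((D : ℝ) * p * n))‖ := by
        positivity
      have h' : (p : ℝ) / 2 * (2 / ((p : ℝ) * Real.sqrt D)) = 1 / Real.sqrt D := by
        rw [div_mul_div_comm, div_eq_div_iff (mul_pos two_pos (mul_pos hp0 hsD)).ne' hsD']
        ring
      have hid : (p : ℝ) / 2 * (‖κs m‖ * ‖as n‖ / n * ‖DeltaW D ((m : ℝ) / ((D : ℝ) * p * n))‖ *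
          (2 / ((p : ℝ) * Real.sqrt D))) =
          ‖κs m‖ * ‖as n‖ / n * ‖DeltaW D ((m : ℝ) / ((D : ℝ) * p * n))‖ * (1 / Real.sqrt D) := by
        rw [← h']; ring
      split_ifs with hpm
      · rw [hid]
      · rw [hid]; positivity
    have hB0' : ∀ m, 0 ≤ Bf n m := fun m => by simp only [hBdef]; split_ifs <;> positivity
    have hsB : Summable (Bf n) := Summable.of_nonneg_of_le hB0' hBA ((hA n hn).1.mul_left _)
    refine ⟨hsB, ?_⟩
    -- re-index `m = pk`
    set h : ℕ → ℝ := fun m => ‖κs m‖ * ‖as n‖ / n *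
      ‖DeltaW D ((m : ℝ) / ((D : ℝ) * p * n))‖ * (1 / Real.sqrt D) with hhdef
    have hBh : ∑' m, Bf n m = ∑' k : ℕ, h (p * k) := by
      rw [← tsum_ite_dvd_eq_tsum_mul hp.pos h]
    have harg : ∀ k : ℕ, (((p * k : ℕ) : ℝ) / ((D : ℝ) * p * n)) = (k : ℝ) / ((D : ℝ) * n) := by
      intro k
      rw [div_eq_div_iff (mul_pos (mul_pos hD0 hp0) hn0).ne' (mul_pos hD0 hn0).ne']
      push_cast
      ring
    set cB : ℝ := ‖as n‖ / n * (1 / Real.sqrt D) with hcB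
    have hcB0 : 0 ≤ cB := by rw [hcB]; positivity
    have hle : ∀ k : ℕ, h (p * k) ≤ cB * (16 * B) * ((k.divisors.card : ℝ) ^ 4 *
        ‖DeltaW D ((k : ℝ) / ((D : ℝ) * n))‖) := by
      intro k
      have h1 : ‖κs (p * k)‖ ≤ B * ((p * k).divisors.card : ℝ) ^ 4 :=
        norm_kappa_le_divisors hB0 h141 (p * k)
      have h2 : ((p * k).divisors.card : ℝ) ^ 4 ≤ (2 * (k.divisors.card : ℝ)) ^ 4 :=
        pow_le_pow_left₀ (Nat.cast_nonneg _) (by exact_mod_cast card_divisors_prime_mul_le hp k) 4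
      have h3 : ‖κs (p * k)‖ ≤ 16 * B * (k.divisors.card : ℝ) ^ 4 := by
        calc ‖κs (p * k)‖ ≤ B * ((p * k).divisors.card : ℝ) ^ 4 := h1
          _ ≤ B * (2 * (k.divisors.card : ℝ)) ^ 4 := mul_le_mul_of_nonneg_left h2 hB0
          _ = 16 * B * (k.divisors.card : ℝ) ^ 4 := by ring
      have hδ0 : 0 ≤ ‖DeltaW D ((k : ℝ) / ((D : ℝ) * n))‖ := norm_nonneg _
      calc h (p * k) = cB * (‖κs (p * k)‖ * ‖DeltaW D ((k : ℝ) / ((D : ℝ) * n))‖) := by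
            simp only [hhdef, hcB]
            rw [harg k]; ring
        _ ≤ cB * (16 * B * (k.divisors.card : ℝ) ^ 4 * ‖DeltaW D ((k : ℝ) / ((D : ℝ) * n))‖) :=
            mul_le_mul_of_nonneg_left (mul_le_mul_of_nonneg_right h3 hδ0) hcB0
        _ = cB * (16 * B) * ((k.divisors.card : ℝ) ^ 4 * ‖DeltaW D ((k : ℝ) / ((D : ℝ) * n))‖) := by
            ring
    have hh0 : ∀ k : ℕ, 0 ≤ h (p * k) := fun k => by simp only [hhdef]; positivity
    have hmaj : Summable (fun k : ℕ => cB * (16 * B) * ((k.divisors.card : ℝ) ^ 4 *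
        ‖DeltaW D ((k : ℝ) / ((D : ℝ) * n))‖)) := hsumY.mul_left _
    have hsh : Summable (fun k : ℕ => h (p * k)) := Summable.of_nonneg_of_le hh0 hle hmaj
    have hkey : (D : ℝ) * n / n / Real.sqrt D = Real.sqrt D := by
      rw [mul_div_assoc, div_self hn0', mul_one, div_eq_iff hsD.ne']
      exact hsqD.symm
    rw [hBh]
    calc ∑' k : ℕ, h (p * k) ≤ ∑' k : ℕ, cB * (16 * B) * ((k.divisors.card : ℝ) ^ 4 *
          ‖DeltaW D ((k : ℝ) / ((D : ℝ) * n))‖) := hsh.tsum_le_tsum hle hmaj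
      _ = cB * (16 * B) * ∑' k : ℕ, (k.divisors.card : ℝ) ^ 4 *
          ‖DeltaW D ((k : ℝ) / ((D : ℝ) * n))‖ := tsum_mul_left
      _ ≤ cB * (16 * B) * (K * ((D : ℝ) * n) * ell D ^ 674) :=
          mul_le_mul_of_nonneg_left hwinY (mul_nonneg hcB0 (mul_nonneg (by norm_num) hB0))
      _ = 16 * ‖as n‖ * B * K * ell D ^ 674 * ((D : ℝ) * n / n / Real.sqrt D) := by
          rw [hcB]; ring
      _ = 16 * ‖as n‖ * B * K * ell D ^ 674 * Real.sqrt D := by rw [hkey]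
      _ = ‖as n‖ * (16 * B * K * ell D ^ 674 * Real.sqrt D) := by ring
      _ ≤ B * (16 * B * K * ell D ^ 674 * Real.sqrt D) :=
          mul_le_mul_of_nonneg_right (h142.1 n)
            (mul_nonneg (mul_nonneg (mul_nonneg (mul_nonneg (by norm_num) hB0) hK0)
              (by positivity)) hsD.le)
      _ = 16 * B ^ 2 * K * Real.sqrt D * ell D ^ 674 := by ring
  -- the majorant series
  have hGs : Summable G := by
    rw [hGdef]
    exact summable_sum (f := fun n m => A n m + Bf n m) fun n hn => ((hA n hn).1.add (hB n hn).1)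
  have hGsum : ∑' m, G m ≤ (N : ℝ) * (18 * B ^ 2 * K * Real.sqrt D * ell D ^ 674) := by
    simp only [hGdef]
    rw [Summable.tsum_finsetSum (fun n hn => ((hA n hn).1.add (hB n hn).1))]
    calc ∑ n ∈ Finset.Icc 1 N, ∑' m, (A n m + Bf n m)
        = ∑ n ∈ Finset.Icc 1 N, (∑' m, A n m + ∑' m, Bf n m) :=
          Finset.sum_congr rfl fun n hn => (hA n hn).1.tsum_add (hB n hn).1
      _ ≤ ∑ n ∈ Finset.Icc 1 N, 18 * B ^ 2 * K * Real.sqrt D * ell D ^ 674 :=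
          Finset.sum_le_sum fun n hn => by linarith [(hA n hn).2, (hB n hn).2]
      _ = (N : ℝ) * (18 * B ^ 2 * K * Real.sqrt D * ell D ^ 674) := by
          rw [Finset.sum_const, Nat.card_Icc, Nat.add_sub_cancel, nsmul_eq_mul]
  -- conclusion
  rw [hdiff]
  have hFnorm : Summable (fun m => ‖F m‖) :=
    Summable.of_nonneg_of_le (fun m => norm_nonneg _) hFG hGs
  calc ‖∑' m, F m‖ ≤ ∑' m, ‖F m‖ := norm_tsum_le_tsum_norm hFnorm
    _ ≤ ∑' m, G m := hFnorm.tsum_le_tsum hFG hGs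
    _ ≤ (N : ℝ) * (18 * B ^ 2 * K * Real.sqrt D * ell D ^ 674) := hGsum
    _ = 18 * B ^ 2 * K * Real.sqrt D * ell D ^ 674 * N := by ring


/-! ## `Z22:§14.u006` (first line) from u004: the edge `step14u006a_of_u004` -/

/-- `Z22:§14.u006` (first line) EDGE, kernel-checked: **u004 ⇒ u006 (first line)** (p. 77, tex
L3862–L3866: "Note that `(n,p) = 1` if `n < 2P₄` and `|τ(χψ_p⁰)| = √D`. Hence … `Σ*_{ψ (mod p)} Ĩ₂(ψ)
= τ(χ)χ(p)D⁻¹ Σ_mΣ_n κ*(m)a*(n)n⁻¹Δ₁(m/(Dpn))e(mD̄n̄/p) + O(PT^{−c})`"), i.e.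
`Typed.Sec14.Step14u004 → Typed.Sec14.Step14u006a`, for every `B`, with `c = min(c₄,1)` and
`C = 2C₄⁺ + 36B²K_W` (`c₄, C₄` the constants of u004, `K_W = (2C₅₃⁺+3)7¹⁶ + 4C₅₃⁺` the window
constant of the tree's Lemma 5.3). Route: sum u004 over the `p − 2` members `ψ (mod p)` of `Ψ`
(`card_finsetOf_p_le`; error `≤ 2PC₄e^{−c₄𝓛¹⁰} ≤ 2PC₄T^{−c}`); move `Σ*_ψ` inside the absolutely
convergent `m`-series (`sum_mainTerm_u004_eq`); `Σ_{ψ≠ψ⁰} τ(χψ̄)ψ(m)ψ̄(n) = [p∤m](τ(χ)χ(p)(p−1)e(mD̄n̄/p)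
− τ(χψ⁰))` for `(n,p) = 1` — u005 (`step14u005_holds`) minus the principal character — where
`(n,p) = 1` as `n ≤ 2P₄ ≤ P < p` (`coprime_of_mem_primeWindow_of_le`) and `|τ(χψ⁰)| = |τ(χ)| = √D`
(`step14p77_holds`, `norm_tau_eq_sqrt`); the coefficient discrepancy is `≤ 2/(p√D) + [p∣m]/√D`
(`norm_coeff_sub_le`) and is summed with `κ*(m) ≤ Bτ₅(m) ≤ Bd(m)⁴`, `|a*(n)| ≤ B` and the window
lemma `Σ_m d(m)⁴|Δ(m/X)| ≤ K_W X𝓛⁶⁷⁴` (`Section14Majorant1413`) at `X = Dpn` and, for the `p ∣ m`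
sub-series re-indexed `m = pk`, at `X = Dn`: total `≤ 36B²K_W√D𝓛⁶⁷⁴P₄ = 36B²K_W·P·√D𝓛¹¹⁹³/T²
≤ 36B²K_W·P·T⁻¹` (`𝓛¹¹⁹³ ≤ D^{1/4}`, `D ≤ T`). Assumption (A) enters only through u004.
[cite: Zhang2022LandauSiegel, §14 u006 p.77, tex L3862–L3866] -/
theorem step14u006a_of_u004 (h4 : Step14u004) : Step14u006a := by
  intro B
  obtain ⟨c₄, hc₄, C₄, D₄, h₄⟩ := h4 B
  obtain ⟨D₅, h₅⟩ := step14u005_holds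
  obtain ⟨D₇, h₇⟩ := step14p77_holds
  obtain ⟨c53, hc53, C53, D₅₃, h53⟩ := lemma53_holds
  obtain ⟨D₁, hD₁⟩ := exists_two_mul_P4_le_bigP
  obtain ⟨D₂, hD₂⟩ := eventually_log_rpow_le_rpow_quarter (1193 : ℝ)
  have hC₀0 : 0 ≤ max C53 0 := le_max_right _ _
  set K : ℝ := (2 * max C53 0 + 3) * 7 ^ 16 + 4 * max C53 0 with hK
  have hK0 : 0 ≤ K := by rw [hK]; positivity
  refine ⟨min c₄ 1, lt_min hc₄ one_pos, 2 * max C₄ 0 + 36 * B ^ 2 * K,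
    max (max (max D₄ D₅) (max D₇ D₅₃)) (max (max D₁ D₂) ⌈Real.exp 3⌉₊),
    fun D _ χ hD hq hprim hA p hpW κs as h141 h142 => ?_⟩
  have hD₄ : D₄ ≤ D :=
    le_trans (le_trans (le_trans (le_max_left _ _) (le_max_left _ _)) (le_max_left _ _)) hD
  have hD₅ : D₅ ≤ D :=
    le_trans (le_trans (le_trans (le_max_right _ _) (le_max_left _ _)) (le_max_left _ _)) hD
  have hD₇ : D₇ ≤ D :=
    le_trans (le_trans (le_trans (le_max_left _ _) (le_max_right _ _)) (le_max_left _ _)) hD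
  have hD₅₃ : D₅₃ ≤ D :=
    le_trans (le_trans (le_trans (le_max_right _ _) (le_max_right _ _)) (le_max_left _ _)) hD
  have hD₁' : D₁ ≤ D :=
    le_trans (le_trans (le_trans (le_max_left _ _) (le_max_left _ _)) (le_max_right _ _)) hD
  have hD₂' : D₂ ≤ D :=
    le_trans (le_trans (le_trans (le_max_right _ _) (le_max_left _ _)) (le_max_right _ _)) hD
  have hD3c : ⌈Real.exp 3⌉₊ ≤ D := le_trans (le_trans (le_max_right _ _) (le_max_right _ _)) hD
  haveI : Fact p.Prime := ⟨(Finset.mem_filter.mp hpW).2⟩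
  have hp : p.Prime := Fact.out
  -- `𝓛 ≥ 3`
  have hDe : Real.exp 3 ≤ D := le_trans (Nat.le_ceil _) (by exact_mod_cast hD3c)
  have hD0 : (0 : ℝ) < D := lt_of_lt_of_le (Real.exp_pos 3) hDe
  have hℓ3 : 3 ≤ ell D := by rw [ell, Real.le_log_iff_exp_le hD0]; exact hDe
  have hℓ1 : 1 ≤ ell D := by linarith
  have hD3 : 3 ≤ D := by
    have h2 := Real.add_one_le_exp (3 : ℝ)
    exact_mod_cast (show (3 : ℝ) ≤ D by linarith)
  have hD1 : (1 : ℝ) ≤ D := by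
    have h2 := Real.add_one_le_exp (3 : ℝ)
    linarith
  have hB0 : 0 ≤ B := (norm_nonneg _).trans (h142.1 0)
  have hp2P : (p : ℝ) < 2 * bigP D := Section7MainTerm.lt_two_mul_bigP_of_mem_primeWindow hℓ1 hpW
  have hP0 : 0 < bigP D := Real.exp_pos _
  have hT0 : 0 < bigT D := Real.exp_pos _
  have hT0' : bigT D ≠ 0 := hT0.ne'
  have hP40 : 0 ≤ P4 D := by
    rw [P4, t0]
    exact mul_nonneg (div_nonneg hP0.le (pow_nonneg hT0.le 2))
      (pow_nonneg (Real.log_natCast_nonneg D) 519)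
  have hNP : (⌊2 * P4 D⌋₊ : ℝ) ≤ bigP D := (Nat.floor_le (by linarith)).trans (hD₁ D hD₁')
  have hN2 : (⌊2 * P4 D⌋₊ : ℝ) ≤ 2 * P4 D := Nat.floor_le (by linarith)
  -- Lemma 5.3 at `D`, with the nonnegative constant `max C₅₃ 0`
  have h53D : ∀ x : ℝ, 0 < x →
      (x ≤ t0 D ^ (1.02 : ℝ) → ‖DeltaW D x - omegaW D (1 / 2 + 2 * π * x * I)‖ ≤
          max C53 0 * alpha D * ‖omegaW D (1 / 2 + 2 * π * x * I)‖ + Real.exp (-c53 * ell D ^ 10)) ∧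
      (t0 D ^ (1.02 : ℝ) < x → ‖DeltaW D x‖ ≤
        max C53 0 * (Real.exp (-((1 : ℝ) / 100 * ell2 D * Real.log x) ^ 2) +
          Real.exp (-(x ^ (0.99 : ℝ)) / ell2 D))) := by
    intro x hx
    have h := h53 D χ hD₅₃ hq hprim x hx
    have hα0 : 0 ≤ alpha D := by
      rw [alpha, bigP, Real.log_exp]
      exact div_nonneg Real.pi_pos.le (pow_nonneg (Real.log_natCast_nonneg D) 9)
    have hω0 : 0 ≤ ‖omegaW D (1 / 2 + 2 * π * x * I)‖ := norm_nonneg _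
    have he0 : 0 ≤ Real.exp (-((1 : ℝ) / 100 * ell2 D * Real.log x) ^ 2) +
        Real.exp (-(x ^ (0.99 : ℝ)) / ell2 D) := by positivity
    refine ⟨fun hx1 => (h.1 hx1).trans ?_, fun hx2 => (h.2 hx2).trans ?_⟩
    · have : C53 * alpha D * ‖omegaW D (1 / 2 + 2 * π * x * I)‖ ≤
          max C53 0 * alpha D * ‖omegaW D (1 / 2 + 2 * π * x * I)‖ :=
        mul_le_mul_of_nonneg_right (mul_le_mul_of_nonneg_right (le_max_left _ _) hα0) hω0
      linarith
    · exact mul_le_mul_of_nonneg_right (le_max_left _ _) he0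
  -- `(n,p) = 1` on the range `1 ≤ n ≤ 2P₄` (`n ≤ 2P₄ ≤ P < p`)
  have hcop : ∀ n ∈ Finset.Icc 1 ⌊2 * P4 D⌋₊, Nat.Coprime n p := fun n hn =>
    (Nat.Coprime.coprime_dvd_right (dvd_mul_left n D)
      (coprime_of_mem_primeWindow_of_le hD₁ hD₁' hD3 hpW hn)).symm
  -- the non-principal character sums
  have hW : ∀ m : ℕ, ∀ n ∈ Finset.Icc 1 ⌊2 * P4 D⌋₊,
      (∑ ψ ∈ (Finset.univ : Finset (DirichletCharacter ℂ p)).erase 1,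
        tauSum (D * p) (DirichletCharacter.changeLevel (dvd_mul_right D p) χ *
            DirichletCharacter.changeLevel (dvd_mul_left p D) ψ⁻¹) *
          ψ (m : ZMod p) * ψ⁻¹ (n : ZMod p)) =
      if p ∣ m then 0 else
        GammaFactor.tau χ * χ (p : ZMod D) * ((p : ℂ) - 1) *
            eAdd ((m : ℝ) * nInv p (D * n) / p) -
          tauSum (D * p) (DirichletCharacter.changeLevel (dvd_mul_right D p) χ *
            DirichletCharacter.changeLevel (dvd_mul_left p D) (1 : DirichletCharacter ℂ p)) :=
    fun m n hn => sum_erase_one_tau_mul χ (h₅ D χ hD₅ hq hprim) hpW (hcop n hn)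
  -- the summed main terms of u004
  set M : ℂ := ∑ x ∈ finsetOf {x : Chr D | x.p = p},
      GammaFactor.tau (psiChi χ x)⁻¹ / ((D : ℂ) * x.p) *
        ∑' m : ℕ, ∑ n ∈ Finset.Icc 1 ⌊2 * P4 D⌋₊,
          κs m * as n * x.ψ (m : ZMod x.p) * conj (x.ψ (n : ZMod x.p)) / (n : ℂ) *
            Lemma53.Delta1_56 (ell2 D) (t0 D) ((m : ℝ) / ((D : ℝ) * x.p * n)) with hM
  have hmain := sum_mainTerm_u004_eq χ hq hD3 h141 as hpW
  -- Part 1: u004 over the `≤ p` members with modulus `p`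
  have h1 : ‖i2Star χ p κs as - M‖ ≤ (p : ℝ) * (max C₄ 0 * Real.exp (-c₄ * ell D ^ 10)) := by
    rw [hM, i2Star, ← Finset.sum_sub_distrib]
    refine (norm_sum_le _ _).trans ?_
    refine (Finset.sum_le_sum (g := fun _ => max C₄ 0 * Real.exp (-c₄ * ell D ^ 10))
      fun x _ => ?_).trans ?_
    · exact (h₄ D χ hD₄ hq hprim hA x κs as h141 h142).trans
        (mul_le_mul_of_nonneg_right (le_max_left _ _) (Real.exp_pos _).le)
    · rw [Finset.sum_const, nsmul_eq_mul]
      exact mul_le_mul_of_nonneg_right (card_finsetOf_p_le hpW)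
        (mul_nonneg (le_max_right _ _) (Real.exp_pos _).le)
  -- Part 2: the main terms minus the target
  have h2 : ‖M - GammaFactor.tau χ * χ (p : ZMod D) / D *
      ∑' m : ℕ, ∑ n ∈ Finset.Icc 1 ⌊2 * P4 D⌋₊, κs m * as n / (n : ℂ) *
        Lemma53.Delta1_56 (ell2 D) (t0 D) ((m : ℝ) / ((D : ℝ) * p * n)) *
          eAdd ((m : ℝ) * nInv p (D * n) / p)‖ ≤
      18 * B ^ 2 * K * Real.sqrt D * ell D ^ 674 * (⌊2 * P4 D⌋₊ : ℝ) := by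
    rw [hM, hmain]
    exact norm_mainTerms_sub_target_le hc53.le hC₀0 hℓ3 h53D hB0 h141 h142 hp hp2P hNP
      (norm_tau_eq_sqrt χ hprim) (h₇ D χ hD₇ hq hprim p hpW) (χ.norm_le_one _)
      (fun m n => (m : ℝ) * nInv p (D * n) / p)
      (fun m n => ∑ ψ ∈ (Finset.univ : Finset (DirichletCharacter ℂ p)).erase 1,
        tauSum (D * p) (DirichletCharacter.changeLevel (dvd_mul_right D p) χ *
            DirichletCharacter.changeLevel (dvd_mul_left p D) ψ⁻¹) *
          ψ (m : ZMod p) * ψ⁻¹ (n : ZMod p)) hW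
  -- growth bookkeeping: `e^{−c₄𝓛¹⁰} ≤ T^{−c}`, `√D𝓛¹¹⁹³ ≤ T`, `2P₄√D𝓛⁶⁷⁴ ≤ 2PT⁻¹ ≤ 2PT^{−c}`
  have hT1 : 1 ≤ bigT D := Real.one_le_exp (Real.rpow_nonneg (by linarith) _)
  have hTc : bigT D ^ (-(1 : ℝ)) ≤ bigT D ^ (-min c₄ 1) :=
    Real.rpow_le_rpow_of_exponent_le hT1 (by linarith [min_le_right c₄ 1])
  have hexp : Real.exp (-c₄ * ell D ^ 10) ≤ bigT D ^ (-min c₄ 1) := by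
    rw [bigT, ← Real.exp_mul, Real.exp_le_exp]
    have hm1 : min c₄ 1 ≤ c₄ := min_le_left _ _
    have hpow : ell D ^ (1.1 : ℝ) ≤ ell D ^ 10 := by
      calc ell D ^ (1.1 : ℝ) ≤ ell D ^ (10 : ℝ) :=
            Real.rpow_le_rpow_of_exponent_le hℓ1 (by norm_num)
        _ = ell D ^ 10 := by
            rw [show (10 : ℝ) = ((10 : ℕ) : ℝ) by norm_num, Real.rpow_natCast]
    have h3 : min c₄ 1 * ell D ^ (1.1 : ℝ) ≤ c₄ * ell D ^ 10 :=
      mul_le_mul hm1 hpow (Real.rpow_nonneg (by linarith) _) hc₄.le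
    linarith
  have hsmall : Real.sqrt D * ell D ^ 1193 ≤ bigT D := by
    have hq1 : ell D ^ 1193 ≤ (D : ℝ) ^ (1 / 4 : ℝ) := by
      have h := hD₂ D hD₂'
      rw [show (1193 : ℝ) = ((1193 : ℕ) : ℝ) by norm_num, Real.rpow_natCast] at h
      exact h
    calc Real.sqrt D * ell D ^ 1193 ≤ (D : ℝ) ^ (1 / 2 : ℝ) * (D : ℝ) ^ (1 / 4 : ℝ) := by
          rw [Real.sqrt_eq_rpow]
          exact mul_le_mul_of_nonneg_left hq1 (Real.rpow_nonneg hD0.le _)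
      _ = (D : ℝ) ^ (3 / 4 : ℝ) := by rw [← Real.rpow_add hD0]; norm_num
      _ ≤ (D : ℝ) ^ (1 : ℝ) := Real.rpow_le_rpow_of_exponent_le hD1 (by norm_num)
      _ = Real.exp (ell D) := by rw [Real.rpow_one, ell, Real.exp_log hD0]
      _ ≤ bigT D := by
          rw [bigT, Real.exp_le_exp]
          calc ell D = ell D ^ (1 : ℝ) := (Real.rpow_one _).symm
            _ ≤ ell D ^ (1.1 : ℝ) := Real.rpow_le_rpow_of_exponent_le hℓ1 (by norm_num)
  have hP4 : Real.sqrt D * ell D ^ 674 * (2 * P4 D) ≤ 2 * bigP D * bigT D ^ (-(1 : ℝ)) := by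
    rw [Real.rpow_neg_one, P4, t0]
    have hid : Real.sqrt D * ell D ^ 674 * (2 * (bigP D / bigT D ^ 2 * ell D ^ 519)) =
        2 * bigP D * (Real.sqrt D * ell D ^ 1193) / bigT D ^ 2 := by
      rw [show (1193 : ℕ) = 674 + 519 by norm_num, pow_add]
      ring
    rw [hid, div_le_iff₀ (pow_pos hT0 2)]
    calc 2 * bigP D * (Real.sqrt D * ell D ^ 1193) ≤ 2 * bigP D * bigT D :=
          mul_le_mul_of_nonneg_left hsmall (by positivity)
      _ = 2 * bigP D * (bigT D)⁻¹ * bigT D ^ 2 := by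
          rw [mul_assoc (2 * bigP D) (bigT D)⁻¹, pow_two, ← mul_assoc (bigT D)⁻¹,
            inv_mul_cancel₀ hT0', one_mul]
  have hmaxC : 0 ≤ max C₄ 0 := le_max_right _ _
  have hTc0 : 0 ≤ bigT D ^ (-min c₄ 1) := Real.rpow_nonneg hT0.le _
  have hterm1 : (p : ℝ) * (max C₄ 0 * Real.exp (-c₄ * ell D ^ 10)) ≤
      2 * bigP D * (max C₄ 0 * bigT D ^ (-min c₄ 1)) :=
    mul_le_mul hp2P.le (mul_le_mul_of_nonneg_left hexp hmaxC)
      (mul_nonneg hmaxC (Real.exp_pos _).le) (by positivity)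
  have hN' : Real.sqrt D * ell D ^ 674 * (⌊2 * P4 D⌋₊ : ℝ) ≤ 2 * bigP D * bigT D ^ (-min c₄ 1) :=
    calc Real.sqrt D * ell D ^ 674 * (⌊2 * P4 D⌋₊ : ℝ)
        ≤ Real.sqrt D * ell D ^ 674 * (2 * P4 D) := mul_le_mul_of_nonneg_left hN2 (by positivity)
      _ ≤ 2 * bigP D * bigT D ^ (-(1 : ℝ)) := hP4
      _ ≤ 2 * bigP D * bigT D ^ (-min c₄ 1) := mul_le_mul_of_nonneg_left hTc (by positivity)
  have hterm2 : 18 * B ^ 2 * K * Real.sqrt D * ell D ^ 674 * (⌊2 * P4 D⌋₊ : ℝ) ≤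
      18 * B ^ 2 * K * (2 * bigP D * bigT D ^ (-min c₄ 1)) := by
    calc 18 * B ^ 2 * K * Real.sqrt D * ell D ^ 674 * (⌊2 * P4 D⌋₊ : ℝ)
        = 18 * B ^ 2 * K * (Real.sqrt D * ell D ^ 674 * (⌊2 * P4 D⌋₊ : ℝ)) := by ring
      _ ≤ 18 * B ^ 2 * K * (2 * bigP D * bigT D ^ (-min c₄ 1)) :=
          mul_le_mul_of_nonneg_left hN' (by positivity)
  -- assemble
  refine (norm_sub_le_norm_sub_add_norm_sub _ M _).trans ?_
  refine (add_le_add h1 h2).trans ?_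
  refine (add_le_add hterm1 hterm2).trans (le_of_eq ?_)
  ring

end Literature.NumberTheory.LFunctions.Zhang2022.Typed.Sec14
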